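import Mathlib

/-!
# Crux `DigitPolyUniformity` (stmt-QuantumAdvantage-1392), line `Sketch` (LAR composition):
# symmetric polynomials are shift-invariant below `2^(n-1)`

Stub X9s of line Sketch/LAR of crux stmt-QuantumAdvantage-1392
(`Summit.QuantumAdvantage.QuantumAdvantage.Theses.MobiusLadder.DigitPolyUniformity`). The neighbouring
stub X9 (`liouville_corr_le_of_shiftInvariant`) bounds the correlation of `λ` with every digital phase
`χ_P(N) = (−1)^{P(bits N)}` that is SHIFT-INVARIANT, i.e. `P(bits 2N) = P(bits N)` whenever `2N < 2ⁿ`.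
This file supplies the main example class: every SYMMETRIC `P ∈ 𝔽₂[x_0, …, x_{n−1}]`
(`MvPolynomial.IsSymmetric`: invariant under renaming by every permutation of the variables; any degree,
e.g. all elementary symmetric polynomials `e_k`, hence all digit-sum weights) is shift-invariant
(`eval_digits_double_of_isSymmetric`).

Proof: for `2N < 2ⁿ` (so `n = m + 1` and `N < 2^m`) the digit vector of `N` is the digit vector of
`2N` composed with the rotation `finRotate (m + 1) : i ↦ i + 1 (mod m + 1)` of `Fin (m + 1)`:
digit `i + 1` of `2N` is digit `i` of `N` for `i < m`, and digit `0` of `2N` is `0`, as is digit `m`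
of `N < 2^m` (`digits_eq_comp_finRotate`). Then `MvPolynomial.eval_rename` and
`rename (finRotate _) P = P` finish. For `n = 0` both digit vectors are the empty function.
Pure bit arithmetic; no named facts; Mathlib only.
-/

namespace Summit.QuantumAdvantage.DigitPolyUniformity.SketchLAR

open Filter Finset

namespace SymmetricShift

/-- Digit `k + 1` of `2N` is digit `k` of `N`. [folklore] -/
theorem testBit_two_mul_succ (N k : ℕ) : Nat.testBit (2 * N) (k + 1) = Nat.testBit N k := by
  rw [Nat.testBit_succ, Nat.mul_div_cancel_left N Nat.two_pos]

/-- Digit `0` of `2N` is `0`. [folklore] -/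
theorem testBit_two_mul_zero (N : ℕ) : Nat.testBit (2 * N) 0 = false := by
  rw [Nat.testBit_zero, Nat.mul_mod_right]
  rfl

/-- **The digit vector of `N` is the digit vector of `2N` rotated.** For `2N < 2ⁿ`, the `𝔽₂`-valued
digit vector `i ↦ bit_i(N)` on `Fin n` equals `(i ↦ bit_i(2N)) ∘ finRotate n`, where
`finRotate n : i ↦ i + 1 (mod n)`: for `i < n − 1` digit `i + 1` of `2N` is digit `i` of `N`, and the
last index `n − 1` is sent to `0`, where digit `0` of `2N` vanishes, as does digit `n − 1` of
`N < 2^(n−1)`. (For `n = 0` both sides are the empty function.) [folklore] -/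
theorem digits_eq_comp_finRotate {n : ℕ} (N : ℕ) (hN : 2 * N < 2 ^ n) :
    (fun i : Fin n => if Nat.testBit N i then (1 : ZMod 2) else 0) =
      (fun i : Fin n => if Nat.testBit (2 * N) i then (1 : ZMod 2) else 0) ∘ finRotate n := by
  cases n with
  | zero => funext i; exact i.elim0
  | succ m =>
    have hNm : N < 2 ^ m := by rw [Nat.pow_succ] at hN; omega
    funext ⟨k, hk⟩
    simp only [Function.comp_apply]
    by_cases h : k < m
    · rw [finRotate_of_lt h, testBit_two_mul_succ]
    · obtain rfl : k = m := by omega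
      rw [finRotate_last', testBit_two_mul_zero, Nat.testBit_lt_two_pow hNm]

end SymmetricShift

/-- **Stub X9s (symmetric polynomials are shift-invariant below `2^{n−1}`).** For `2N < 2ⁿ` the digit
vector of `2N` is the digit vector of `N` composed with the rotation `i ↦ i − 1` of `Fin n` (the top
digit of `N` is `0` and becomes digit `0` of `2N`), so every SYMMETRIC `P` (`MvPolynomial.IsSymmetric`:
invariant under renaming by every permutation) takes the same value at both (`MvPolynomial.eval_rename`).
With X9 (`liouville_corr_le_of_shiftInvariant`): `3·|Σ_{N<2ⁿ} λ χ_P| ≤ 2ⁿ + 1` for every symmetric `P`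
of every degree, unconditionally. [folklore] -/
theorem eval_digits_double_of_isSymmetric {n : ℕ} (P : MvPolynomial (Fin n) (ZMod 2))
    (hP : P.IsSymmetric) :
    ∀ N : ℕ, 2 * N < 2 ^ n →
      MvPolynomial.eval (fun i : Fin n => if Nat.testBit (2 * N) i then (1 : ZMod 2) else 0) P =
        MvPolynomial.eval (fun i : Fin n => if Nat.testBit N i then (1 : ZMod 2) else 0) P := by
  intro N hN
  rw [SymmetricShift.digits_eq_comp_finRotate N hN, ← MvPolynomial.eval_rename, hP (finRotate n)]

end Summit.QuantumAdvantage.DigitPolyUniformity.SketchLAR
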